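import Literature.ModelTheory.Quasiminimal.KappaAxioms
import Literature.NumberTheory.Transcendental.ZilberFieldExistenceProofs
import Literature.NumberTheory.Transcendental.SEACOrbits
import Literature.ModelTheory.Quasiminimal.OrbitLanguage
import HarnessLib

/-!
# Zilber's existence theorem from a countable quasiminimal chart over `SK`

B. Zilber, *Pseudo-exponentiation on algebraically closed fields of characteristic zero*, Ann.
Pure Appl. Logic 132 (2005), Thm 1.1 (existence half): there is a pseudo-exponential field of
every uncountable cardinality — the tree's named fact
`Literature.NumberTheory.Transcendental.exists_isZilberField_of_aleph0_lt`. Its proof (Zilber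
2005 §5, completed by Bays–Kirby 2018, Thm 9.1 with Thm 8.2, Kirby 2010, Thm 4.2 and Kirby 2013,
§2.3) has three parts: (a) the countable model `M(SK)` and its quasiminimal pregeometry
structure (Bays–Kirby Thm 5.9, Thm 6.9); (b) the models of every uncountable cardinality as
unions of the directed system of closed self-embeddings of the countable model, to which the
axioms transfer (Kirby 2010 Thm 4.2, Bays–Kirby Thm 8.2 — in the tree:
`Literature/ModelTheory/Quasiminimal/KappaModel.lean`, `KappaAxioms.lean`); (c) the
identification of the transferred axioms (Thm 8.2 over the base `SK`: kernel `ℤτ`, `SK ◁ F`,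
axiom 4 over `Γ(SK) ∪ a`, CCP for finite sets) with Zilber's (standard kernel, Schanuel property,
strong exponential-algebraic closedness in genericity form, CCP) — Bays–Kirby §9.1 and Kirby 2013
§2.3 (in the tree: `ZilberFieldExistenceProofs.lean`,
`IsZilberField.of_isStrong_span_kernelGenerator`).

This file assembles (b) + (c): given a countable quasiminimal exponential chart over `SK` — a
countable algebraically closed exponential field `M` with a weakly quasiminimal pregeometry
structure and a basis (`S : Setup L M cl`) over a base field `K ∋ τ`, `τ` transcendental,
embedded by `ιM` and fixed by all partial self-embeddings, with surjective `exp` of kernel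
`ℤ ιM(τ)`, `ℚ ιM(τ) ◁ M`, axiom 4 over `ℚ ιM(τ)` and `ecl ⊆ cl` (for `M(SK)` these are
Bays–Kirby Thm 5.9, Thm 6.9, Thm 8.2 and Remark 10.10) —

* `isZilberField_model_of_chart` — the model `S.Model I` over ANY infinite linear order `I` is a
  Zilber field (of cardinality `#I`, `Setup.mk_model`);
* `exists_isZilberField_of_aleph0_lt_of_chart` — hence Zilber's existence theorem holds.

It then discharges the base-form side conditions from the axioms *of the countable model itself*,
in the form in which the countable model is produced (Kirby 2013 FPEF §2 / Bays–Kirby Thm 5.9: a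
countable ELA-field with standard kernel, the Schanuel property and strong exponential-algebraic
closedness) and in which its chart is produced (Bays–Kirby Thm 6.9 with Remark 6.6: the orbit
language of a group `G ≤ Aut(M / ecl S₀)`, `Literature/ModelTheory/Quasiminimal/OrbitLanguage.lean`,
`SEACOrbits.lean`):

* `exists_isZilberField_of_aleph0_lt_of_setup` — for ANY language and closure operator `cl ⊇ ecl`:
  a chart on a countable algebraically closed exponential field with surjective `exp`, kernel
  `ℤτ`, the Schanuel property and SEAC whose partial self-embeddings fix `τ` gives the theorem
  (base `K := ℚ(τ)`: partial self-embeddings are E-ring endomorphisms fixing `τ`, hence fix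
  `ℚ(τ)`; `ℚτ ◁ M` is the Schanuel property, `schanuelProperty_iff_isStrong_span_kernelGenerator`;
  axiom 4 over `ℚτ ∪ ā` is SEAC over `ā, τ`, `IsStronglyExpAlgClosed.isLinIndepExpAlgClosed`);
* `apply_eq_of_isQFEmbOn_orbitLanguage` — in the orbit language of `G ≤ Aut(M / ecl S₀)` partial
  self-embeddings fix `ecl S₀` pointwise, in particular the kernel (`expKernel_subset_ecl`);
* `exists_isZilberField_of_aleph0_lt_of_orbitSetup` — hence a countable ELA-field with standard
  kernel, the Schanuel property and SEAC carrying a chart in such an orbit language, for a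
  closure operator containing `ecl`, yields `exists_isZilberField_of_aleph0_lt`.

What remains of Zilber's theorem after this file is (a): the countable strongly
exponentially-algebraically closed model (Zilber 2005 §§3–5; Kirby 2013 FPEF; Bays–Kirby Thm 5.9 —
`PseudoExpChainAxioms.lean` gives its ELA + standard kernel + Schanuel + infinite-dimension part)
and its quasiminimal pregeometry structure in the orbit language (Bays–Kirby Thm 6.9 —
`SEACOrbits.lean`, `SEACNonSplitting.lean`).

## References

* B. Zilber, *Pseudo-exponentiation on algebraically closed fields of characteristic zero*,
  Ann. Pure Appl. Logic 132 (2005), Thm 1.1, §5.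
* M. Bays, J. Kirby, *Pseudo-exponential maps, variants, and quasiminimality*, Algebra & Number
  Theory 12 (2018), Thm 1.7, Thm 5.9, Thm 6.9, Thm 8.2, Thm 9.1 and its proof, Remark 10.10.
* J. Kirby, *On quasiminimal excellent classes*, J. Symbolic Logic 75 (2010), Thm 4.2.
* J. Kirby, *A note on the axioms for Zilber's pseudo-exponential fields*, Notre Dame J. Formal
  Logic 54 (2013), §2.3.
-/

noncomputable section

suppress_compilation

open Set Cardinal
open Literature.ModelTheory.ExponentialFields Literature.ModelTheory.ExponentialFields.ExponentialRing

namespace Literature.NumberTheory.Transcendental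

open GammaField FirstOrder FirstOrder.Language Literature.ModelTheory.Quasiminimal

section Base

variable {K F : Type*} [Field K] [CharZero K] [Field F] [CharZero F]

/-- The `ℚ`-span of the image of the line `ℚτ` under a field embedding is the line `ℚ ι(τ)`.
[folklore] -/
theorem span_image_span_singleton (ι : K →+* F) (τ : K) :
    Submodule.span ℚ (ι '' ↑(Submodule.span ℚ ({τ} : Set K))) = Submodule.span ℚ {ι τ} := by
  have : (ι : K → F) = ι.toRatAlgHom.toLinearMap := rfl
  rw [this, Submodule.span_image, Submodule.span_eq, Submodule.map_span, Set.image_singleton]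

end Base

section Chart

variable {L : Language.{0, 0}} {M : Type} [L.Structure M] [Field M] [CharZero M] [IsAlgClosed M]
  [ExponentialRing M] {cl : Set M → Set M}
  {K : Type} [Field K] [CharZero K] (ιM : K →+* M) {τ : K}

/-- **The models over a chart over `SK` are Zilber fields** (Bays–Kirby 2018, Thm 8.2 with
Thm 9.1, along Kirby 2010, Thm 4.2): for a countable quasiminimal exponential chart `S` over a
base `K ∋ τ` of the standard-kernel type (`τ` transcendental, `ker exp = ℤ ιM(τ)`, `ℚ ιM(τ) ◁ M`,
axiom 4 over `ℚ ιM(τ)`, `ecl ⊆ cl`, surjective `exp`, base fixed by partial self-embeddings), the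
model `S.Model I` over any infinite linear order `I` (`KappaModel.lean`) is a Zilber field: the
axioms transfer to it in base form (`KappaAxioms.lean`) and the base form over `SK` is Zilber's
(`IsZilberField.of_isStrong_span_kernelGenerator`, `isLinIndepExpAlgClosed_of_base`).
[cite: BaysKirby2018ANT, Thm 8.2 and Thm 9.1] [cite: Kirby2010QMEC, Thm 4.2] -/
theorem isZilberField_model_of_chart (S : Setup L M cl) (hτ : Transcendental ℚ τ)
    (hfix : ∀ σ : M → M, IsQFEmbOn L σ Set.univ → ∀ k, σ (ιM k) = ιM k)
    (hsurj : IsSurjectiveOntoUnits M)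
    (hker : expKernel M = AddSubgroup.zmultiples (ιM τ))
    (hstrong : IsStrong (Submodule.span ℚ (ιM '' ↑(Submodule.span ℚ ({τ} : Set K)))))
    (h4 : ∀ (n : ℕ) (W : Set (Fin n ⊕ Fin n → M)), IsIrreducibleClosed M W →
      (W ∩ torusLocus M n).Nonempty → IsRotund M n (W ∩ torusLocus M n) →
      IsAddFree M n (W ∩ torusLocus M n) → IsMulFree M n (W ∩ torusLocus M n) →
      zariskiDim M W = n →
      ∀ A : Finset M, ∃ z ∈ W ∩ expGraph M n,
        ∀ m : Fin n → ℤ, (∑ i, (m i : M) * z (Sum.inl i)) ∈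
          Submodule.span ℚ (ιM '' ↑(Submodule.span ℚ ({τ} : Set K)) ∪ ↑A) → m = 0)
    (hecl : ∀ A : Set M, ecl A ⊆ cl A) (I : Type) [LinearOrder I] [Infinite I] :
    IsZilberField (S.Model I) := by
  have hτ' : Transcendental ℚ (S.baseEmb I ιM τ) := fun halg =>
    hτ ((isAlgebraic_algHom_iff (S.baseEmb I ιM).toRatAlgHom
      (fun _ _ hab => (S.baseEmb I ιM).injective hab)).mp halg)
  have hstrong' : IsStrong (Submodule.span ℚ {S.baseEmb I ιM τ}) := by
    rw [← span_image_span_singleton]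
    exact S.isStrong_model ιM hfix hstrong
  exact IsZilberField.of_isStrong_span_kernelGenerator (S.isAlgClosed_model I)
    (S.isSurjectiveOntoUnits_model I hsurj) hτ' (S.expKernel_model_eq ιM hfix hker) hstrong'
    (isLinIndepExpAlgClosed_of_base _ (S.axiom4_model ιM hfix _ h4))
    (S.countable_ecl_model hecl)

/-- **Zilber's existence theorem from a countable quasiminimal chart over `SK`** (Zilber 2005,
Thm 1.1, existence half, along its own proof line as completed by Bays–Kirby 2018, Thm 9.1 with
Thm 8.2, Kirby 2010, Thm 4.2 and Kirby 2013, §2.3): given such a chart there is a Zilber field of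
every uncountable cardinality `κ` — the model over `I = κ.ord.ToType` — so the tree's named fact
`exists_isZilberField_of_aleph0_lt` holds. What this leaves of Zilber's theorem is the
construction of the chart over `SK` (Zilber 2005 §§3–5 / Bays–Kirby 2018 Thm 5.9, Thm 6.9: the
countable saturated strong amalgam `M(SK)` and its quasiminimal pregeometry structure).
[cite: Zilber2005, Thm 1.1] -/
theorem exists_isZilberField_of_aleph0_lt_of_chart (S : Setup L M cl) (hτ : Transcendental ℚ τ)
    (hfix : ∀ σ : M → M, IsQFEmbOn L σ Set.univ → ∀ k, σ (ιM k) = ιM k)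
    (hsurj : IsSurjectiveOntoUnits M)
    (hker : expKernel M = AddSubgroup.zmultiples (ιM τ))
    (hstrong : IsStrong (Submodule.span ℚ (ιM '' ↑(Submodule.span ℚ ({τ} : Set K)))))
    (h4 : ∀ (n : ℕ) (W : Set (Fin n ⊕ Fin n → M)), IsIrreducibleClosed M W →
      (W ∩ torusLocus M n).Nonempty → IsRotund M n (W ∩ torusLocus M n) →
      IsAddFree M n (W ∩ torusLocus M n) → IsMulFree M n (W ∩ torusLocus M n) →
      zariskiDim M W = n →
      ∀ A : Finset M, ∃ z ∈ W ∩ expGraph M n,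
        ∀ m : Fin n → ℤ, (∑ i, (m i : M) * z (Sum.inl i)) ∈
          Submodule.span ℚ (ιM '' ↑(Submodule.span ℚ ({τ} : Set K)) ∪ ↑A) → m = 0)
    (hecl : ∀ A : Set M, ecl A ⊆ cl A) :
    exists_isZilberField_of_aleph0_lt := by
  intro κ hκ
  set I : Type := κ.ord.ToType with hI
  haveI : Infinite I :=
    Cardinal.infinite_iff.2 (by rw [hI, Cardinal.mk_ord_toType]; exact hκ.le)
  exact ⟨S.Model I, inferInstance, inferInstance, inferInstance,
    isZilberField_model_of_chart ιM S hτ hfix hsurj hker hstrong h4 hecl I,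
    by rw [S.mk_model I, hI, Cardinal.mk_ord_toType]⟩

end Chart

section AnyLanguage

variable {L : Language.{0, 0}} {M : Type} [L.Structure M] [Field M] [CharZero M] [IsAlgClosed M]
  [ExponentialRing M] {cl : Set M → Set M}

/-- **Zilber's existence theorem from a chart on a countable SEAC model with standard kernel and
the Schanuel property** (Zilber 2005, Thm 1.1, along Bays–Kirby 2018, Thm 9.1 with Thm 8.2 and
Kirby 2010, Thm 4.2): if a countable algebraically closed exponential field `M` with surjective
`exp`, kernel `ℤτ` (`τ` transcendental), the Schanuel property and strong exponential-algebraic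
closedness carries a countable quasiminimal exponential chart `Setup L M cl` (any language `L`,
any closure operator `cl ⊇ ecl`) whose partial self-embeddings fix `τ`, then there is a Zilber
field of every uncountable cardinality. The base of `ZilberFieldExistenceChart` is taken to be
`K = ℚ(τ) ≤ M`: partial self-embeddings are E-ring endomorphisms (`Setup.hom_of_isQFEmbOn`)
fixing `τ`, hence fix `ℚ(τ)` (`RingHom.eqOn_field_closure`); `ℚτ ◁ M` is the Schanuel property
(`schanuelProperty_iff_isStrong_span_kernelGenerator`); axiom 4 over `ℚτ ∪ ā` is Kirby's scheme
over `ā, τ` (`IsStronglyExpAlgClosed.isLinIndepExpAlgClosed`).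
[cite: Zilber2005, Thm 1.1] [cite: BaysKirby2018ANT, Thm 8.2 and Thm 9.1 (proof)] -/
theorem exists_isZilberField_of_aleph0_lt_of_setup (S : Setup L M cl) {τ : M}
    (hτ : Transcendental ℚ τ) (hker : expKernel M = AddSubgroup.zmultiples τ)
    (hfixτ : ∀ σ : M → M, IsQFEmbOn L σ Set.univ → σ τ = τ)
    (hsurj : IsSurjectiveOntoUnits M) (hSP : SchanuelProperty M)
    (hSEAC : IsStronglyExpAlgClosed M) (hecl : ∀ A : Set M, ecl A ⊆ cl A) :
    exists_isZilberField_of_aleph0_lt := by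
  classical
  set K : Subfield M := Subfield.closure ({τ} : Set M) with hK
  have hτK : τ ∈ K := Subfield.subset_closure (Set.mem_singleton τ)
  set τ' : K := ⟨τ, hτK⟩ with hτ'
  have hsub : (K.subtype : K → M) τ' = τ := rfl
  -- `τ'` is transcendental
  have hτ't : Transcendental ℚ τ' := by
    have hinj : Function.Injective (algebraMap K M) := Subtype.val_injective
    exact (transcendental_algebraMap_iff hinj).1 (by exact hτ)
  -- the image of the line `ℚτ'` spans the line `ℚτ`
  have hspan : Submodule.span ℚ (K.subtype '' ↑(Submodule.span ℚ ({τ'} : Set K))) =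
      Submodule.span ℚ {τ} := by
    rw [span_image_span_singleton]; rfl
  have hexp : exp τ = 1 := by
    rw [← mem_expKernel_iff, hker]
    exact AddSubgroup.mem_zmultiples τ
  refine exists_isZilberField_of_aleph0_lt_of_chart K.subtype S hτ't ?_ hsurj hker ?_ ?_ hecl
  · -- partial self-embeddings fix `ℚ(τ)` pointwise
    intro σ hσ k
    obtain ⟨e, he⟩ := S.hom_of_isQFEmbOn σ hσ
    have heq : Set.EqOn (e.toRingHom : M → M) (RingHom.id M) ({τ} : Set M) := by
      intro x hx
      rw [Set.mem_singleton_iff] at hx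
      subst hx
      simpa [← he] using hfixτ σ hσ
    have := RingHom.eqOn_field_closure heq k.2
    simpa [← he] using this
  · -- `ℚτ ◁ M` from the Schanuel property
    rw [hspan]
    exact (schanuelProperty_iff_isStrong_span_kernelGenerator hτ hexp).1 hSP
  · -- axiom 4 over `ℚτ ∪ A` from SEAC
    intro n W hirr hne hrot hadd hmul hdim A
    obtain ⟨z, hz, hlin⟩ :=
      hSEAC.isLinIndepExpAlgClosed n W hirr hne hrot hadd hmul hdim (insert τ A)
    refine ⟨z, hz, fun m hm => hlin m ?_⟩
    have hle : Submodule.span ℚ (K.subtype '' ↑(Submodule.span ℚ ({τ'} : Set K)) ∪ ↑A) ≤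
        Submodule.span ℚ (↑(insert τ A) : Set M) := by
      rw [Submodule.span_union, hspan, ← Submodule.span_union, Set.singleton_union,
        Finset.coe_insert]
    exact hle hm

end AnyLanguage

section OrbitLanguage

variable {M : Type} [Field M] [ExponentialRing M]

/-- **Partial self-embeddings in the orbit language of `G ≤ Aut(M / ecl S)` fix `ecl S`
pointwise** (Bays–Kirby 2018, Remark 6.6: partial embeddings are locally in `G`; `G` fixes the
closure of the base). [cite: BaysKirby2018ANT, Remark 6.6 and Thm 6.9 (proof)] -/
theorem apply_eq_of_isQFEmbOn_orbitLanguage [Γ : OrbitGroup M] {S₀ : Set M}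
    (hΓ : Γ.G ≤ SEACModel.baseAut S₀) {σ : M → M}
    (hσ : IsQFEmbOn (orbitLanguage M) σ Set.univ) {x : M} (hx : x ∈ ecl S₀) : σ x = x := by
  obtain ⟨g, hg, hgx⟩ := (isQFEmbOn_iff (Γ := Γ)).1 hσ ![x] (fun _ => Set.mem_univ _)
  have h0 := congrFun hgx 0
  simp only [Function.comp_apply, Matrix.cons_val_zero] at h0
  rw [← h0]
  exact SEACModel.apply_eq_of_mem_baseAut (hΓ hg) hx

/-- In particular partial self-embeddings in such an orbit language fix every kernel element
(`ker exp ⊆ ecl S`, Kirby 2010, Lemma 3.3). [cite: Kirby2010, Lemma 3.3] -/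
theorem apply_eq_of_isQFEmbOn_orbitLanguage_of_mem_expKernel [Γ : OrbitGroup M] {S₀ : Set M}
    (hΓ : Γ.G ≤ SEACModel.baseAut S₀) {σ : M → M}
    (hσ : IsQFEmbOn (orbitLanguage M) σ Set.univ) {x : M} (hx : x ∈ expKernel M) : σ x = x :=
  apply_eq_of_isQFEmbOn_orbitLanguage hΓ hσ (expKernel_subset_ecl S₀ hx)

/-- **Zilber's existence theorem from a countable SEAC model with a chart in the orbit language**
(Zilber 2005, Thm 1.1, existence, along Bays–Kirby 2018: Thm 5.9 + Thm 6.9 ⟹ Thm 8.2 ⟹ Thm 9.1):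
a countable algebraically closed exponential field with surjective `exp`, standard kernel, the
Schanuel property and strong exponential-algebraic closedness, which is a (weakly) quasiminimal
pregeometry structure with a basis in the orbit language of a group `G ≤ Aut(M / ecl S₀)` for a
closure operator containing `ecl` (`Setup`), yields a Zilber field of every uncountable
cardinality. [cite: Zilber2005, Thm 1.1] [cite: BaysKirby2018ANT, Thm 6.9, Thm 8.2, Thm 9.1] -/
theorem exists_isZilberField_of_aleph0_lt_of_orbitSetup [CharZero M] [IsAlgClosed M]
    [Γ : OrbitGroup M] {S₀ : Set M}
    (hΓ : Γ.G ≤ SEACModel.baseAut S₀) {cl : Set M → Set M}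
    (S : Setup (orbitLanguage M) M cl) (hstd : HasStandardKernel M)
    (hsurj : IsSurjectiveOntoUnits M) (hSP : SchanuelProperty M)
    (hSEAC : IsStronglyExpAlgClosed M) (hecl : ∀ A : Set M, ecl A ⊆ cl A) :
    exists_isZilberField_of_aleph0_lt := by
  obtain ⟨τ, hτ, hker⟩ := hstd
  refine exists_isZilberField_of_aleph0_lt_of_setup S hτ hker (fun σ hσ => ?_) hsurj hSP hSEAC hecl
  refine apply_eq_of_isQFEmbOn_orbitLanguage_of_mem_expKernel hΓ hσ ?_
  rw [hker]
  exact AddSubgroup.mem_zmultiples τ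

end OrbitLanguage

end Literature.NumberTheory.Transcendental

end
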